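import Summits.NavierStokesRegularity.NavierStokesRegularity.Theorems.ExtremiserTransienceNearExtremalTransienceExtremiserLiouvilleConstantSpeedDecayLiouvilleTools
import HarnessLib

/-!
# Crux `ExtremiserTransience.NearExtremalTransience` (stmt-NavierStokesRegularity-21883), line `extremiser_liouville`,
# stub K1b — THE DECAY-GAP LIOUVILLE: a constant-speed divergence-free field with `‖w − c‖ = O(|x|^{-a})`, `a > 1`, is constant

`--supports stmt-NavierStokesRegularity-21883` (helper).  Author: prover seat `ns-el-k1b` (g4).

g3's L² flux Liouville (`…ConstantSpeedL2Liouville`) kills every constant-speed divergence-free `C¹` field with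
`∫‖w − c‖² < ∞` (pointwise tails `|x|^{-a}`, `a > 3/2`); g4's explicit example (`…ConstantSpeedExample{,FarField}`) is such a
field, non-constant, with an exact `|x|⁻¹` tail.  THIS FILE closes the window in between:

* `eq_zero_of_constSpeedDeviation_decay_axial`: `V ∈ C¹`, `div V = 0`, `⟪V, c⟫ = −‖V‖²/2` (`c = (0,0,c₂) ≠ 0`), and
  **`‖V(x)‖ ≤ C (1 + ‖x‖)^{-a}` for some `a > 1`** ⟹ `V ≡ 0`;
* `eq_farField_of_constSpeed_of_decay_axial`: the same for `w = c + V` with `‖w‖ ≡ ‖c‖`.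

So the K1b residue object (constant-speed analytic extended extremiser, far field `c`) is NOT `O(|x|^{-a})` for any `a > 1`:
together with the example, **its deviation from the far field is an exact `|x|⁻¹` tail** — the regime the record's heuristic
far-field analysis (item 7, condition (C): `q ∈ L¹`) must exclude via the multiplier.

MECHANISM (the anisotropic flux argument of g3 with decay instead of `L²`, and the ORDER OF LIMITS `ρ → ∞` THEN `T → ∞`).  Test
`div V = 0` against `arctan⟪c,x⟫ · k_T(x₂) · χ_ρ(x_h)` (`integral_testFactor_weight_eq`):
`½∫k_Tχ_ρ‖V‖²/(1+⟪c,x⟫²) = ∫arctan · [k_T Dχ_ρ(V_h) + χ_ρ k_T'(V₂)]`.  The transverse leak lives on the shell `ρ ≤ |x_h| ≤ 2ρ`,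
`|x₂| ≤ 2T`, where `‖V‖ ≤ C(1+ρ)^{-a}`: it is `≲ T ρ (1+ρ)^{-a} → 0` as `ρ → ∞` (volume of the solid cylinder,
`volume_solidCylinder`).  The axial leak is quadratic (`V₂ = −‖V‖²/(2c₂)`) and lives on the slab `T ≤ |x₂| ≤ 2T`, where
`(1+‖x‖)^{-2a} ≤ (1+T)^{-(a-1)}(1+|x_h|)^{-(a+1)}`; by Fubini in `(x₂, x_h)` (`cylSplit`) and `∫_{ℝ²}(1+|y|)^{-(a+1)} < ∞`
(`integrable_one_add_norm`, `a + 1 > 2`) it is `≲ (1+T)^{1-a}`, uniformly in `ρ`.  Hence `∫k_T‖V‖²/(1+⟪c,x⟫²) ≲ (1+T)^{1-a}`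
(dominated convergence in `ρ`), and `T → ∞` gives `V ≡ 0`.

WHAT THIS IS NOT: K1b is NOT proved (the exact `|x|⁻¹` regime remains, and is populated by non-extremal fields); nothing here
proves NS regularity. [folklore]
-/

noncomputable section

open Set Filter Topology MeasureTheory Metric Function
open scoped ENNReal NNReal Topology InnerProductSpace RealInnerProductSpace ContDiff
open Literature.Analysis.FluidPDE Literature.Analysis

namespace Summit.NavierStokesRegularity.NavierStokesRegularity.Theorems

-- the problem directory repeats the summit name (`NavierStokesRegularity/NavierStokesRegularity`)
set_option linter.dupNamespace false

namespace ExtremiserLiouville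

variable {V : EuclideanSpace ℝ (Fin 3) → EuclideanSpace ℝ (Fin 3)} {c : EuclideanSpace ℝ (Fin 3)}

/-! ## The key estimate: `∫ k_T ‖V‖²/(1+⟪c,x⟫²) ≤ K (1+T)^{1-a}` -/

/-- **Key estimate.**  For `V ∈ C¹` divergence free with `⟪V, c⟫ = −‖V‖²/2`, `c = (0,0,c₂) ≠ 0`, and
`‖V(x)‖ ≤ C₀(1+‖x‖)^{-a}`, `a > 1`: there is `K` with `∫ k_T(x₂)‖V‖²/(1+⟪c,x⟫²) ≤ K·(1+T)^{-(a-1)}` for all `T > 0`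
(anisotropic cut-off, `ρ → ∞` by dominated convergence, Fubini bound of the axial leak on the slab). [folklore] -/
theorem integral_axialCutoff_weight_le_of_decay (hV : ContDiff ℝ 1 V) (hdiv : VectorCalculus.IsDivFree V)
    (hVc : ∀ x, ⟪V x, c⟫ = -(‖V x‖ ^ 2 / 2)) (hc0 : c 0 = 0) (hc1 : c 1 = 0) (hc2 : c 2 ≠ 0)
    {a C₀ : ℝ} (ha : 1 < a) (hC₀ : 0 ≤ C₀) (hdec : ∀ x, ‖V x‖ ≤ C₀ * (1 + ‖x‖) ^ (-a)) :
    ∃ K : ℝ, ∀ T : ℝ, 0 < T →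
      (∫ x, cutoff T (x 2) * (‖V x‖ ^ 2 / (1 + ⟪c, x⟫ ^ 2))) ≤ K * (1 + T) ^ (-(a - 1)) := by
  obtain ⟨C₁, hC₁, hC1⟩ := exists_norm_fderiv_cutoff_le (E := ℝ)
  obtain ⟨C₂, hC₂, hC2⟩ := exists_norm_fderiv_cutoff_le (E := EuclideanSpace ℝ (Fin 3))
  obtain ⟨P, hP⟩ := exists_transverseProj
  set I : ℝ := ∫ w : EuclideanSpace ℝ (Fin 2), (1 + ‖w‖) ^ (-(a + 1)) with hI
  have hI0 : 0 ≤ I := integral_nonneg fun w => Real.rpow_nonneg (by positivity) _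
  set v₁ : ℝ := (volume (ball (0 : EuclideanSpace ℝ (Fin 2)) 1)).toReal with hv₁
  have hv₁0 : 0 ≤ v₁ := ENNReal.toReal_nonneg
  refine ⟨2 * Real.pi * C₁ * C₀ ^ 2 * I / |c 2|, fun T hT => ?_⟩
  set e₂ : EuclideanSpace ℝ (Fin 3) := EuclideanSpace.single (2 : Fin 3) (1 : ℝ) with he₂
  set k : EuclideanSpace ℝ (Fin 3) → ℝ := fun x => cutoff T (x 2) with hkdef
  have hk2 : k = fun x => cutoff T ((EuclideanSpace.proj (2 : Fin 3) : EuclideanSpace ℝ (Fin 3) →L[ℝ] ℝ) x) := rfl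
  have hk : ContDiff ℝ 1 k := by
    rw [hk2]; exact (contDiff_cutoff T).comp (EuclideanSpace.proj (2 : Fin 3) : EuclideanSpace ℝ (Fin 3) →L[ℝ] ℝ).contDiff
  have hk01 : ∀ x, 0 ≤ k x ∧ k x ≤ 1 := fun x => ⟨cutoff_nonneg _ _, cutoff_le_one _ _⟩
  have hk0 : ∀ x : EuclideanSpace ℝ (Fin 3), 2 * T < |x 2| → k x = 0 := fun x hx => by
    rw [hkdef]; exact cutoff_eq_zero hT (by rw [Real.norm_eq_abs]; exact hx.le)
  have hP_norm : ∀ v : EuclideanSpace ℝ (Fin 3), ‖P v‖ ≤ ‖v‖ := fun v => by rw [hP]; exact norm_transverseProj_le v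
  have hPcyl : ∀ x : EuclideanSpace ℝ (Fin 3), cylRadius x = ‖P x‖ := fun x => by rw [hP]; exact cylRadius_eq_norm_sub_smul x
  -- the weight and its weighted density
  set w : EuclideanSpace ℝ (Fin 3) → ℝ := fun x => ‖V x‖ ^ 2 / (1 + ⟪c, x⟫ ^ 2) with hwdef
  have hw0 : ∀ x, 0 ≤ w x := fun x => by positivity
  have hwle : ∀ x, w x ≤ ‖V x‖ ^ 2 := fun x => div_le_self (sq_nonneg _) (by nlinarith [sq_nonneg ⟪c, x⟫])
  have hVx2 : ∀ x, |V x 2| = ‖V x‖ ^ 2 / (2 * |c 2|) := fun x => by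
    have h := hVc x
    have hinner : ⟪V x, c⟫ = V x 2 * c 2 := by
      simp only [PiLp.inner_apply, RCLike.inner_apply, conj_trivial, Fin.sum_univ_three, hc0, hc1]; ring
    rw [hinner] at h
    have e : V x 2 = -(‖V x‖ ^ 2 / 2) / c 2 := by field_simp; linarith
    rw [e, abs_div, abs_neg, abs_of_nonneg (by positivity : (0 : ℝ) ≤ ‖V x‖ ^ 2 / 2)]
    field_simp
  -- the slab majorant of the axial leak (uniform in `ρ`)
  set A : ℝ := Real.pi / 2 * (C₁ / T) * (C₀ ^ 2 / (2 * |c 2|)) * (1 + T) ^ (-(a - 1)) with hA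
  have hA0 : 0 ≤ A := by positivity
  set MT : EuclideanSpace ℝ (Fin 3) → ℝ := fun x =>
    A * ({x : EuclideanSpace ℝ (Fin 3) | |x 2| ≤ 2 * T}).indicator (fun x => (1 + cylRadius x) ^ (-(a + 1))) x with hMT
  obtain ⟨hslab_int, hslab_val⟩ := integrable_slab_cylRadius_rpow (p := a + 1) (by linarith) (L := 2 * T) (by linarith)
  have hMT_int : Integrable MT volume := hslab_int.const_mul A
  have hMT_val : ∫ x, MT x = A * (2 * (2 * T) * I) := by rw [hMT, integral_const_mul, hslab_val]
  -- the limit object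
  have hkw_int : Integrable (fun x => k x * w x) volume :=
    integrable_axialCutoff_weight_of_decay hV.continuous ha hdec hT
  -- ### the estimate at finite `ρ`
  have hρ_est : ∀ ρ : ℝ, 0 < ρ →
      (∫ x, k x * cutoff ρ (P x) * w x) ≤
        2 * (Real.pi / 2 * (C₂ / ρ * (C₀ * (1 + ρ) ^ (-a))) * (volume (solidCylinder (2 * ρ) (2 * T))).toReal +
          ∫ x, MT x) := by
    intro ρ hρ
    set χ : EuclideanSpace ℝ (Fin 3) → ℝ := fun x => cutoff ρ (P x) with hχdef
    have hχ : ContDiff ℝ 1 χ := (contDiff_cutoff ρ).comp P.contDiff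
    have hK : ContDiff ℝ 1 fun x => k x * χ x := hk.mul hχ
    have hχ01 : ∀ x, 0 ≤ χ x ∧ χ x ≤ 1 := fun x => ⟨cutoff_nonneg _ _, cutoff_le_one _ _⟩
    have hχ0 : ∀ x : EuclideanSpace ℝ (Fin 3), 2 * ρ < ‖P x‖ → χ x = 0 := fun x hx => by
      rw [hχdef]; exact cutoff_eq_zero hρ hx.le
    -- support inside the solid cylinder
    have hsupp : ∀ x, k x * χ x ≠ 0 → x ∈ solidCylinder (2 * ρ) (2 * T) := by
      intro x hx
      have hkx : k x ≠ 0 := left_ne_zero_of_mul hx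
      have hχx : χ x ≠ 0 := right_ne_zero_of_mul hx
      refine ⟨?_, ?_⟩
      · rw [hPcyl]; by_contra h; exact hχx (hχ0 x (not_le.1 h))
      · by_contra h; exact hkx (hk0 x (not_le.1 h))
    have hKc : HasCompactSupport fun x => k x * χ x := by
      refine HasCompactSupport.intro ((isCompact_closedBall (0 : EuclideanSpace ℝ (Fin 3)) (2 * ρ + 2 * T))) fun x hx => ?_
      by_contra h
      obtain ⟨h1, h2⟩ := hsupp x h
      apply hx
      rw [mem_closedBall_zero_iff]
      have hsq : ‖x‖ ^ 2 = cylRadius x ^ 2 + x 2 ^ 2 := by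
        rw [EuclideanSpace.real_norm_sq_eq, Fin.sum_univ_three, cylRadius_sq]
      have hcr := cylRadius_nonneg x
      nlinarith [sq_abs (x 2), abs_nonneg (x 2), norm_nonneg x]
    -- the tested identity
    have hid := integral_testFactor_weight_eq hV hdiv hVc hK hKc
    -- derivative of the product along `V`
    have hDk : ∀ x, fderiv ℝ k x (V x) = fderiv ℝ (cutoff (E := ℝ) T) (x 2) (V x 2) := fun x => by
      have h : HasFDerivAt k ((fderiv ℝ (cutoff (E := ℝ) T) (x 2)).comp
          (EuclideanSpace.proj (2 : Fin 3) : EuclideanSpace ℝ (Fin 3) →L[ℝ] ℝ)) x := by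
        rw [hk2]
        exact (((contDiff_cutoff (n := 1) T).differentiable one_ne_zero) _).hasFDerivAt.comp x
          (EuclideanSpace.proj (2 : Fin 3) : EuclideanSpace ℝ (Fin 3) →L[ℝ] ℝ).hasFDerivAt
      rw [h.fderiv]; rfl
    have hDχ : ∀ x, fderiv ℝ χ x (V x) = fderiv ℝ (cutoff ρ) (P x) (P (V x)) := fun x => by
      have h : HasFDerivAt χ ((fderiv ℝ (cutoff ρ) (P x)).comp P) x :=
        (((contDiff_cutoff (n := 1) ρ).differentiable one_ne_zero) _).hasFDerivAt.comp x P.hasFDerivAt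
      rw [h.fderiv]; rfl
    have hDK : ∀ x, fderiv ℝ (fun x => k x * χ x) x (V x) =
        k x * fderiv ℝ (cutoff ρ) (P x) (P (V x)) + χ x * fderiv ℝ (cutoff (E := ℝ) T) (x 2) (V x 2) := by
      intro x
      have hk' : HasFDerivAt k (fderiv ℝ k x) x := ((hk.differentiable one_ne_zero) x).hasFDerivAt
      have hχ' : HasFDerivAt χ (fderiv ℝ χ x) x := ((hχ.differentiable one_ne_zero) x).hasFDerivAt
      have hm : HasFDerivAt (fun x => k x * χ x) (k x • fderiv ℝ χ x + χ x • fderiv ℝ k x) x := hk'.mul hχ'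
      rw [hm.fderiv]
      show k x • fderiv ℝ χ x (V x) + χ x • fderiv ℝ k x (V x) = _
      rw [smul_eq_mul, smul_eq_mul, hDk, hDχ]
    -- pointwise bound of `arctan⟪c,x⟫ · DK(V)`
    set Bt : ℝ := Real.pi / 2 * (C₂ / ρ * (C₀ * (1 + ρ) ^ (-a))) with hBt
    have hBt0 : 0 ≤ Bt := by positivity
    set bound : EuclideanSpace ℝ (Fin 3) → ℝ := fun x =>
      Bt * (solidCylinder (2 * ρ) (2 * T)).indicator (fun _ => (1 : ℝ)) x + MT x with hbound
    have hptw : ∀ x, ‖Real.arctan ⟪c, x⟫ * fderiv ℝ (fun x => k x * χ x) x (V x)‖ ≤ bound x := by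
      intro x
      rw [hDK x, Real.norm_eq_abs, abs_mul]
      have ha' : |Real.arctan ⟪c, x⟫| ≤ Real.pi / 2 :=
        abs_le.2 ⟨(Real.neg_pi_div_two_lt_arctan _).le, (Real.arctan_lt_pi_div_two _).le⟩
      -- transverse term
      have hB : |k x * fderiv ℝ (cutoff ρ) (P x) (P (V x))| ≤
          C₂ / ρ * (C₀ * (1 + ρ) ^ (-a)) * (solidCylinder (2 * ρ) (2 * T)).indicator (fun _ => (1 : ℝ)) x := by
        by_cases hann : ρ ≤ ‖P x‖ ∧ ‖P x‖ ≤ 2 * ρ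
        · by_cases hkx : k x = 0
          · rw [hkx, zero_mul, abs_zero]; exact mul_nonneg (by positivity) (indicator_nonneg (fun _ _ => zero_le_one) _)
          · have hxcyl : x ∈ solidCylinder (2 * ρ) (2 * T) := by
              refine ⟨by rw [hPcyl]; exact hann.2, ?_⟩
              by_contra h; exact hkx (hk0 x (not_le.1 h))
            rw [indicator_of_mem hxcyl, mul_one, abs_mul, abs_of_nonneg (hk01 x).1]
            have h1 : |fderiv ℝ (cutoff ρ) (P x) (P (V x))| ≤ C₂ / ρ * ‖V x‖ := by
              rw [← Real.norm_eq_abs]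
              calc ‖fderiv ℝ (cutoff ρ) (P x) (P (V x))‖ ≤ ‖fderiv ℝ (cutoff ρ) (P x)‖ * ‖P (V x)‖ :=
                    (fderiv ℝ (cutoff ρ) (P x)).le_opNorm _
                _ ≤ (C₂ / ρ) * ‖V x‖ := mul_le_mul (hC2 ρ hρ (P x)) (hP_norm (V x)) (norm_nonneg _) (by positivity)
            have h2 : ‖V x‖ ≤ C₀ * (1 + ρ) ^ (-a) := by
              have hxn : ρ ≤ ‖x‖ := hann.1.trans (hP_norm x)
              calc ‖V x‖ ≤ C₀ * (1 + ‖x‖) ^ (-a) := hdec x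
                _ ≤ C₀ * (1 + ρ) ^ (-a) :=
                    mul_le_mul_of_nonneg_left (Real.rpow_le_rpow_of_nonpos (by positivity) (by linarith) (by linarith)) hC₀
            calc k x * |fderiv ℝ (cutoff ρ) (P x) (P (V x))| ≤ 1 * (C₂ / ρ * ‖V x‖) :=
                  mul_le_mul (hk01 x).2 h1 (abs_nonneg _) zero_le_one
              _ ≤ C₂ / ρ * (C₀ * (1 + ρ) ^ (-a)) := by rw [one_mul]; exact mul_le_mul_of_nonneg_left h2 (by positivity)
        · have h0 : fderiv ℝ (cutoff ρ) (P x) (P (V x)) = 0 := by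
            rw [fderiv_cutoff_eq_zero_of_notMem hρ hann]; rfl
          rw [h0, mul_zero, abs_zero]
          exact mul_nonneg (by positivity) (indicator_nonneg (fun _ _ => zero_le_one) _)
      -- axial term
      have hAx : Real.pi / 2 * |χ x * fderiv ℝ (cutoff (E := ℝ) T) (x 2) (V x 2)| ≤ MT x := by
        by_cases hsl : T ≤ |x 2| ∧ |x 2| ≤ 2 * T
        · have hmem : x ∈ {x : EuclideanSpace ℝ (Fin 3) | |x 2| ≤ 2 * T} := hsl.2
          rw [hMT]
          simp only [indicator_of_mem hmem]
          rw [abs_mul, abs_of_nonneg (hχ01 x).1]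
          have h1 : |fderiv ℝ (cutoff (E := ℝ) T) (x 2) (V x 2)| ≤ C₁ / T * |V x 2| := by
            rw [← Real.norm_eq_abs, ← Real.norm_eq_abs (V x 2)]
            exact ((fderiv ℝ (cutoff (E := ℝ) T) (x 2)).le_opNorm _).trans
              (mul_le_mul_of_nonneg_right (hC1 T hT (x 2)) (norm_nonneg _))
          have h2 : |V x 2| ≤ C₀ ^ 2 / (2 * |c 2|) * ((1 + T) ^ (-(a - 1)) * (1 + cylRadius x) ^ (-(a + 1))) := by
            rw [hVx2 x]
            have := (sq_norm_le_of_decay hdec x).trans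
              (mul_le_mul_of_nonneg_left (rpow_neg_two_mul_le_slab ha hT.le hsl.1) (sq_nonneg C₀))
            have hc : 0 < 2 * |c 2| := by positivity
            calc ‖V x‖ ^ 2 / (2 * |c 2|) ≤ C₀ ^ 2 * ((1 + T) ^ (-(a - 1)) * (1 + cylRadius x) ^ (-(a + 1))) / (2 * |c 2|) :=
                  div_le_div_of_nonneg_right this hc.le
              _ = _ := by ring
          calc Real.pi / 2 * (χ x * |fderiv ℝ (cutoff (E := ℝ) T) (x 2) (V x 2)|)
              ≤ Real.pi / 2 * (1 * (C₁ / T * (C₀ ^ 2 / (2 * |c 2|) * ((1 + T) ^ (-(a - 1)) * (1 + cylRadius x) ^ (-(a + 1)))))) := by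
                gcongr
                · exact (hχ01 x).2
                · exact h1.trans (mul_le_mul_of_nonneg_left h2 (by positivity))
            _ = A * (1 + cylRadius x) ^ (-(a + 1)) := by rw [hA]; ring
        · have h0 : fderiv ℝ (cutoff (E := ℝ) T) (x 2) (V x 2) = 0 := by
            rw [fderiv_cutoff_real_eq_zero_of_notMem hT hsl]; rfl
          rw [h0, mul_zero, abs_zero, mul_zero]
          exact mul_nonneg hA0 (indicator_nonneg (fun y _ => Real.rpow_nonneg (by have := cylRadius_nonneg y; positivity) _) _)
      calc |Real.arctan ⟪c, x⟫| * |k x * fderiv ℝ (cutoff ρ) (P x) (P (V x)) + χ x * fderiv ℝ (cutoff (E := ℝ) T) (x 2) (V x 2)|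
          ≤ Real.pi / 2 * (|k x * fderiv ℝ (cutoff ρ) (P x) (P (V x))| + |χ x * fderiv ℝ (cutoff (E := ℝ) T) (x 2) (V x 2)|) :=
            mul_le_mul ha' (abs_add_le _ _) (abs_nonneg _) (by positivity)
        _ = Real.pi / 2 * |k x * fderiv ℝ (cutoff ρ) (P x) (P (V x))| +
              Real.pi / 2 * |χ x * fderiv ℝ (cutoff (E := ℝ) T) (x 2) (V x 2)| := by ring
        _ ≤ Bt * (solidCylinder (2 * ρ) (2 * T)).indicator (fun _ => (1 : ℝ)) x + MT x := by
            refine add_le_add ?_ hAx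
            rw [hBt, mul_assoc]
            exact mul_le_mul_of_nonneg_left hB (by positivity)
    -- integrability of the bound and its integral
    have hcyl_int : Integrable (fun x => (solidCylinder (2 * ρ) (2 * T)).indicator (fun _ => (1 : ℝ)) x) volume := by
      rw [integrable_indicator_iff (measurableSet_solidCylinder _ _)]
      exact integrableOn_const (volume_solidCylinder_lt_top _ _).ne
    have hbound_int : Integrable bound volume := (hcyl_int.const_mul Bt).add hMT_int
    have hbound_val : ∫ x, bound x = Bt * (volume (solidCylinder (2 * ρ) (2 * T))).toReal + ∫ x, MT x := by
      rw [hbound, integral_add (hcyl_int.const_mul Bt) hMT_int, integral_const_mul,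
        integral_indicator (measurableSet_solidCylinder _ _), setIntegral_const, smul_eq_mul, mul_one, Measure.real]
    -- conclusion at finite `ρ`
    have hrhs : (∫ x, Real.arctan ⟪c, x⟫ * fderiv ℝ (fun x => k x * χ x) x (V x)) ≤ ∫ x, bound x :=
      (le_abs_self _).trans ((abs_integral_le_integral_abs (μ := volume)
        (f := fun x => Real.arctan ⟪c, x⟫ * fderiv ℝ (fun x => k x * χ x) x (V x))).trans
        (integral_mono_of_nonneg (Eventually.of_forall fun x => abs_nonneg _) hbound_int
          (Eventually.of_forall fun x => by
            have h := hptw x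
            rwa [Real.norm_eq_abs] at h)))
    have hlhs : (∫ x, k x * cutoff ρ (P x) * w x) = ∫ x, k x * χ x * (‖V x‖ ^ 2 / (1 + ⟪c, x⟫ ^ 2)) := rfl
    rw [hlhs, hid, ← hbound_val]
    linarith
  -- ### `ρ → ∞` by dominated convergence
  have hlim : Tendsto (fun n : ℕ => ∫ x, k x * cutoff ((n : ℝ) + 1) (P x) * w x) atTop (𝓝 (∫ x, k x * w x)) := by
    refine tendsto_integral_of_dominated_convergence (fun x => k x * w x) (fun n => ?_) hkw_int (fun n => ?_) ?_
    · refine Continuous.aestronglyMeasurable ?_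
      have hkc : Continuous k := hk.continuous
      have hχc : Continuous fun x => cutoff ((n : ℝ) + 1) (P x) := (contDiff_cutoff (n := 0) _).continuous.comp P.continuous
      have hwc : Continuous w := by
        refine (hV.continuous.norm.pow 2).div (continuous_const.add ((continuous_const.inner continuous_id).pow 2)) fun x => ?_
        have : (0 : ℝ) < 1 + ⟪c, x⟫ ^ 2 := by positivity
        exact this.ne'
      exact (hkc.mul hχc).mul hwc
    · refine Eventually.of_forall fun x => ?_
      rw [Real.norm_eq_abs, abs_of_nonneg (mul_nonneg (mul_nonneg (hk01 x).1 (cutoff_nonneg _ _)) (hw0 x))]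
      calc k x * cutoff ((n : ℝ) + 1) (P x) * w x ≤ k x * 1 * w x :=
            mul_le_mul_of_nonneg_right (mul_le_mul_of_nonneg_left (cutoff_le_one _ _) (hk01 x).1) (hw0 x)
        _ = k x * w x := by rw [mul_one]
    · refine Eventually.of_forall fun x => ?_
      have hev : ∀ᶠ n : ℕ in atTop, k x * cutoff ((n : ℝ) + 1) (P x) * w x = k x * w x := by
        filter_upwards [eventually_ge_atTop ⌈‖P x‖⌉₊] with n hn
        have hρ : ‖P x‖ ≤ (n : ℝ) + 1 := by
          have := Nat.le_ceil ‖P x‖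
          have hn' : (⌈‖P x‖⌉₊ : ℝ) ≤ n := by exact_mod_cast hn
          linarith
        rw [cutoff_eq_one (by positivity) hρ, mul_one]
      exact tendsto_const_nhds.congr' (hev.mono fun n hn => hn.symm)
  -- the transverse constants tend to `0`
  have hτ : Tendsto (fun n : ℕ => 2 * (Real.pi / 2 * (C₂ / ((n : ℝ) + 1) * (C₀ * (1 + ((n : ℝ) + 1)) ^ (-a))) *
      (volume (solidCylinder (2 * ((n : ℝ) + 1)) (2 * T))).toReal + ∫ x, MT x)) atTop (𝓝 (2 * (0 + ∫ x, MT x))) := by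
    refine (Tendsto.add ?_ tendsto_const_nhds).const_mul 2
    have hform : ∀ n : ℕ, Real.pi / 2 * (C₂ / ((n : ℝ) + 1) * (C₀ * (1 + ((n : ℝ) + 1)) ^ (-a))) *
        (volume (solidCylinder (2 * ((n : ℝ) + 1)) (2 * T))).toReal =
        (8 * Real.pi * C₂ * C₀ * T * v₁) * (((n : ℝ) + 1) * (1 + ((n : ℝ) + 1)) ^ (-a)) := by
      intro n
      rw [volume_solidCylinder_toReal (by positivity) (by positivity), ← hv₁]
      field_simp
      ring
    simp_rw [hform]
    rw [show (0 : ℝ) = (8 * Real.pi * C₂ * C₀ * T * v₁) * 0 by ring]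
    refine Tendsto.const_mul _ ?_
    -- `(n+1)(2+n)^{-a} ≤ (n+2)^{1-a} → 0`
    have h1 : Tendsto (fun n : ℕ => (1 + ((n : ℝ) + 1)) ^ (-(a - 1))) atTop (𝓝 0) := by
      have ht : Tendsto (fun n : ℕ => 1 + ((n : ℝ) + 1)) atTop atTop :=
        tendsto_atTop_add_const_left _ 1 (tendsto_atTop_add_const_right _ 1 tendsto_natCast_atTop_atTop)
      exact (tendsto_rpow_neg_atTop (by linarith : 0 < a - 1)).comp ht
    refine squeeze_zero (fun n => by positivity) (fun n => ?_) h1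
    have hn0 : (0 : ℝ) < 1 + ((n : ℝ) + 1) := by positivity
    have e : (1 + ((n : ℝ) + 1)) ^ (-(a - 1)) = (1 + ((n : ℝ) + 1)) * (1 + ((n : ℝ) + 1)) ^ (-a) := by
      rw [show -(a - 1) = 1 + (-a) by ring, Real.rpow_add hn0, Real.rpow_one]
    rw [e]
    exact mul_le_mul_of_nonneg_right (by linarith) (Real.rpow_nonneg hn0.le _)
  have hle : (∫ x, k x * w x) ≤ 2 * (0 + ∫ x, MT x) :=
    le_of_tendsto_of_tendsto' hlim hτ fun n => hρ_est ((n : ℝ) + 1) (by positivity)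
  -- ### bookkeeping of the constant
  calc (∫ x, cutoff T (x 2) * (‖V x‖ ^ 2 / (1 + ⟪c, x⟫ ^ 2))) = ∫ x, k x * w x := rfl
    _ ≤ 2 * (0 + ∫ x, MT x) := hle
    _ = 2 * Real.pi * C₁ * C₀ ^ 2 * I / |c 2| * ((1 + T) ^ (-(a - 1)) * (T / T)) := by
        rw [zero_add, hMT_val, hA]; ring
    _ = 2 * Real.pi * C₁ * C₀ ^ 2 * I / |c 2| * (1 + T) ^ (-(a - 1)) := by rw [div_self hT.ne', mul_one]


/-! ## The decay-gap Liouville theorems -/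

/-- **Decay-gap Liouville (deviation form, axial far field).**  `V ∈ C¹`, `div V = 0`, `⟪V, c⟫ = −‖V‖²/2` with
`c = (0,0,c₂)`, `c₂ ≠ 0`, and `‖V(x)‖ ≤ C₀ (1 + ‖x‖)^{-a}` for some `a > 1` ⟹ `V ≡ 0`. [folklore] -/
theorem eq_zero_of_constSpeedDeviation_decay_axial (hV : ContDiff ℝ 1 V) (hdiv : VectorCalculus.IsDivFree V)
    (hVc : ∀ x, ⟪V x, c⟫ = -(‖V x‖ ^ 2 / 2)) (hc0 : c 0 = 0) (hc1 : c 1 = 0) (hc2 : c 2 ≠ 0)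
    {a C₀ : ℝ} (ha : 1 < a) (hC₀ : 0 ≤ C₀) (hdec : ∀ x, ‖V x‖ ≤ C₀ * (1 + ‖x‖) ^ (-a)) : ∀ x, V x = 0 := by
  obtain ⟨K, hK⟩ := integral_axialCutoff_weight_le_of_decay hV hdiv hVc hc0 hc1 hc2 ha hC₀ hdec
  set w : EuclideanSpace ℝ (Fin 3) → ℝ := fun x => ‖V x‖ ^ 2 / (1 + ⟪c, x⟫ ^ 2) with hwdef
  have hw0 : ∀ x, 0 ≤ w x := fun x => by positivity
  have hwc : Continuous w := by
    refine (hV.continuous.norm.pow 2).div (continuous_const.add ((continuous_const.inner continuous_id).pow 2)) fun x => ?_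
    have : (0 : ℝ) < 1 + ⟪c, x⟫ ^ 2 := by positivity
    exact this.ne'
  intro x₀
  set R : ℝ := ‖x₀‖ + 1 with hR
  have hRpos : 0 < R := by positivity
  set g : EuclideanSpace ℝ (Fin 3) → ℝ := fun x => cutoff R x * w x with hg
  have hg0 : ∀ x, 0 ≤ g x := fun x => mul_nonneg (cutoff_nonneg _ _) (hw0 x)
  have hgc : Continuous g := (contDiff_cutoff (n := 0) R).continuous.mul hwc
  have hgcs : HasCompactSupport g := (hasCompactSupport_cutoff hRpos).mul_right
  have hgi : Integrable g volume := hgc.integrable_of_hasCompactSupport hgcs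
  -- `∫ g ≤ K (1+T)^{1-a}` for `T ≥ 2R`
  have hgle : ∀ T : ℝ, 2 * R ≤ T → (∫ x, g x) ≤ K * (1 + T) ^ (-(a - 1)) := by
    intro T hT
    have hTpos : 0 < T := by linarith
    refine le_trans (integral_mono hgi (integrable_axialCutoff_weight_of_decay hV.continuous ha hdec hTpos)
      fun x => ?_) (hK T hTpos)
    refine mul_le_mul_of_nonneg_right ?_ (hw0 x)
    by_cases hx : 2 * R ≤ ‖x‖
    · rw [cutoff_eq_zero hRpos hx]; exact cutoff_nonneg _ _
    · have h2 : ‖x 2‖ ≤ T := by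
        have := (abs_two_le_norm_and_cylRadius_le_norm x).1
        rw [Real.norm_eq_abs]; linarith [not_le.1 hx]
      rw [cutoff_eq_one hTpos h2]; exact cutoff_le_one _ _
  -- `T → ∞`
  have hlim : Tendsto (fun n : ℕ => K * (1 + ((n : ℝ) + 2 * R)) ^ (-(a - 1))) atTop (𝓝 (K * 0)) := by
    refine Tendsto.const_mul K ?_
    have ht : Tendsto (fun n : ℕ => 1 + ((n : ℝ) + 2 * R)) atTop atTop :=
      tendsto_atTop_add_const_left _ 1 (tendsto_atTop_add_const_right _ (2 * R) tendsto_natCast_atTop_atTop)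
    exact (tendsto_rpow_neg_atTop (by linarith : 0 < a - 1)).comp ht
  have hint_le : (∫ x, g x) ≤ K * 0 :=
    ge_of_tendsto hlim (Eventually.of_forall fun n => hgle ((n : ℝ) + 2 * R) (by linarith [(Nat.cast_nonneg n : (0 : ℝ) ≤ n)]))
  have hint0 : (∫ x, g x) = 0 := le_antisymm (by simpa using hint_le) (integral_nonneg hg0)
  have hae : g =ᵐ[volume] 0 := (integral_eq_zero_iff_of_nonneg hg0 hgi).1 hint0
  have hfun : g = fun _ => (0 : ℝ) := (Continuous.ae_eq_iff_eq volume hgc continuous_const).1 hae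
  have hgx : g x₀ = 0 := congrFun hfun x₀
  have hcut : cutoff R x₀ = 1 := cutoff_eq_one hRpos (by rw [hR]; linarith)
  have hwx : w x₀ = 0 := by simpa [hg, hcut] using hgx
  rw [hwdef, div_eq_zero_iff] at hwx
  rcases hwx with h | h
  · exact norm_eq_zero.1 (pow_eq_zero_iff two_ne_zero |>.1 h)
  · exact absurd h (by positivity)

/-- **Decay-gap Liouville (axial far field).**  A `C¹` divergence-free field `w` on `ℝ³` with CONSTANT SPEED
`‖w‖ ≡ M = ‖c‖`, `c = (0, 0, c₂) ≠ 0`, and `‖w(x) − c‖ ≤ C₀(1 + ‖x‖)^{-a}` for some `a > 1` is the constant `c`.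
(The example `…ConstantSpeedExample` shows `a = 1` does NOT suffice.) [folklore] -/
theorem eq_farField_of_constSpeed_of_decay_axial {w : EuclideanSpace ℝ (Fin 3) → EuclideanSpace ℝ (Fin 3)}
    (hw : ContDiff ℝ 1 w) (hdiv : VectorCalculus.IsDivFree w) {M : ℝ} (hM : ∀ x, ‖w x‖ = M) (hcM : ‖c‖ = M)
    (hc0 : c 0 = 0) (hc1 : c 1 = 0) (hc2 : c 2 ≠ 0) {a C₀ : ℝ} (ha : 1 < a) (hC₀ : 0 ≤ C₀)
    (hdec : ∀ x, ‖w x - c‖ ≤ C₀ * (1 + ‖x‖) ^ (-a)) : ∀ x, w x = c := by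
  set V : EuclideanSpace ℝ (Fin 3) → EuclideanSpace ℝ (Fin 3) := fun x => w x - c with hVdef
  have hV : ContDiff ℝ 1 V := hw.sub contDiff_const
  have hVdiv : VectorCalculus.IsDivFree V := isDivFree_sub_const hdiv c
  have hVc : ∀ x, ⟪V x, c⟫ = -(‖V x‖ ^ 2 / 2) := fun x => by
    have h : ‖c + V x‖ = ‖c‖ := by simp only [hVdef, add_sub_cancel]; rw [hM x, hcM]
    exact (inner_eq_of_norm_add_eq h).1
  have h0 := eq_zero_of_constSpeedDeviation_decay_axial hV hVdiv hVc hc0 hc1 hc2 ha hC₀ hdec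
  intro x
  have := h0 x
  simpa [hVdef, sub_eq_zero] using this
end ExtremiserLiouville

end Summit.NavierStokesRegularity.NavierStokesRegularity.Theorems

end
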